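import Literature.IUT.HodgeTheaters.PuncturedEllipticCoveringsArrowClaimsOfModLCuspLaws
import Literature.IUT.HodgeTheaters.PuncturedEllipticCoveringsEps0Ramification
import Literature.IUT.HodgeTheaters.PuncturedEllipticCoveringsCor12OfGeomOriginEx48
import HarnessLib

/-!
# [IUTchI] §1 / Cor. 1.2: the ramification of the zero cusp `ε⁰` in `X̲→ → X̲` (GAP-LEDGER G-L5d4g6-1, binder `h0`)
# DERIVED from two ORIENTATION laws of the cusp inertia of `Δ_X̲` — proof-only

Mochizuki, *Inter-universal Teichmüller theory I*, kurims manuscript (May 2020), §1 pp. 37–38 (the quotients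
`Δ_X̲ ↠ Δ_X̲^{ab} ⊗ ℤ/l ↠ Δ_ε ↠ Δ_ε⁺`, `Π_{X̲→} := D_{2ε̲} · Ker(Π_X̲ ↠ J_X ↠ J_X/Im σ)`) and Cor. 1.2, proof p. 39
l. 28–31: «the decomposition groups of `ε⁰`, `ε′`, `ε″` […] may be recovered as the decomposition groups of cusps […]
whose image in `Gal(X̲→/X̲) = Π_X̲/Π_{X̲→}` is nontrivial» [cite: Mochizuki2012, IUTchI Cor 1.2 p.39] (D-0012 claim key;
series status DISPUTED — nothing of the series is asserted here).

PROOF-ONLY companion (cell abc-iut, seat abc-iut-w6-d032 gen 7; offer «EPS0-FROM-ORIENTED-ORIGIN» on STATUS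
2026-08-27T04:39Z; no `def`, no instance, no new `Prop` fact).  GAP-LEDGER row G-L5d4g6-1 records that the binder
`h0 : ¬ D.inertia D.ε0 ≤ D.piXarrow` («`ε⁰` is RAMIFIED in `X̲→ → X̲`») of every [IUTchI] Cor. 1.2 closer is NOT a
consequence of the typed §1 record and the typed §1 claims (kernel independence: abc-iut-L5-t1 `inertia_ε0_clause_independent`
— the UNORIENTED finite model —, abc-iut-L5-t7 `PuncturedEllipticData.not_forall_not_inertia_ε0_le_piXarrow`), that for prime
`l` it is EQUIVALENT to the law «`I_{ε⁰} · jKer = Δ_X̲`» (`ArrowCoveringClaims.not_inertia_ε0_le_piXarrow_iff_sup`), and that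
«the deciding print input is ∏ of cyclotomically ORIENTED cusp-inertia generators of `Δ_X̲ ∈ [Δ_X̲, Δ_X̲]` + ι̲ preserves
the orientation of `I_{ε⁰}`» (D-G-L5d4g6-1-1 and D-G-L5d4g6-1-2).  THIS FILE proves exactly that implication in the kernel: from

* (O1) «ORIENTED PRODUCT RELATION at `ε⁰, ε′, ε″`»: there are generators `z₀ ∈ I_{ε⁰}`, `z₁ ∈ I_{ε′}` (topological
  generator), `z₂ ∈ I_{ε″}` with `z₀ z₁ z₂ ∈ Ker(Δ_X̲ ↠ Δ_ε)` — the image in `Δ_ε` of the surface relation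
  `[α, β] · ∏_c γ_c = 1` of `Δ_X̲` (genus `1`, `l` punctures) for cyclotomically coherent generators `γ_c` (the other
  `l − 3` inertia classes die in `Δ_ε` by definition; by (L4) the class of a coherent generator in `Δ_X̲^{ab} ⊗ ℤ/l` does
  not depend on the chosen decomposition group);
* (O2) «ι̲ PRESERVES THE ORIENTATION OF `I_{ε⁰}`»: for `ι̲ ∈ Δ_C̲ ∖ Δ_X̲` and `z ∈ I_{ε⁰}`,
  `ι̲ z ι̲⁻¹ z⁻¹ ∈ Ker(Δ_X̲ ↠ Δ_X̲^{ab} ⊗ ℤ/l)` — conjugation by the geometric involution fixes the cusp `ε⁰`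
  (`CuspGalois.act_ε0`) AND carries a positive generator of `I_{ε⁰}` to a `Δ_X̲`-conjugate of itself, not of its inverse
  (the clause the unoriented model violates: there `ℓ(c′₀) = 0`, genuinely `ℓ(c₀) = −2`);

together with the typed `Δ_ε`-level laws (L0) (L2a) (L2c) (L4) of abc-iut-L5-t1's `ModLCuspLaws`, the cusp action
`CuspGalois` and a geometric representative `ι̲` of `Gal(X̲/C̲)`, we get `¬ I_{ε⁰} ⊆ jKer`, hence the binder `h0`
(`piXarrow ∩ Δ_C = jKer`) and, for prime `l`, the law «`I_{ε⁰} · jKer = Δ_X̲`».  COMPUTATION (abc-iut-L5-t1's ι-trace,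
`CuspGalois.trace_mem_deltaEpsKer_of_mem_jKer`): if `z₀ ∈ jKer` then `z₀ · ι̲ z₀ ι̲⁻¹ ∈ Ker(↠ Δ_ε)`; by (O2)
`ι̲ z₀ ι̲⁻¹ ≡ z₀`, so `z₀² ∈ Ker(↠ Δ_ε)`, and `l` odd with `z₀^l ∈ Ker` gives `z₀ ∈ Ker(↠ Δ_ε)`; then (O1) puts `z₁ z₂`,
hence (L2c) `z₁`, hence (L0) all of `I_{ε′}`, inside `Ker(↠ Δ_ε)` — contradicting (L2a) «`I_{ε′} ≅ ℤ/l` in `Δ_ε`» as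
`l ≥ 5`.  In `Δ_ε`-coordinates: `(1 − ι) i₀ = 0`, `i₀ = −(i₁ + i₂)`, so `i₀ ≡ −2 i₁ ≠ 0` in `Δ_ε⁺ ≅ ℤ/l`.

Then the [IUTchI] Cor. 1.2 GRAND KNIT over a class of [AbsTopI] Example 4.8 (i)
(`InitialThetaData.pe_characteristicNatureOfCoverings_of_geomOrigin_ex48`, p496734) is re-stated with its two GAP
binders `h0 h0′` REPLACED by (O1) (O2) at the two data (`…_of_geomOrigin_ex48_orientedEps0`): the Cor. 1.2 telescope then
carries NO GAP-LEDGER binder — DATA, three FACT rows by name (F-0193, F-0294, F-0206), the class shape, the eight printed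
`Δ_ε`-sentences, and the two + two orientation laws (O1) (O2), which are ORIGIN-shaped (classical structure of the étale
`π₁` of the `l`-punctured genus-`1` curve `X̲_{k̄}` with its elliptic involution, like abc-iut-L5-t1's `GeomOrigin` (A) (c′)
(e)) and are asserted for no instance.

HONEST FRAMING: (O1) (O2) are assumption-shaped binders about the specific curves, not theorems about every
`PuncturedEllipticData` and not FACT-LIST items; this file DERIVES `h0` from them, it does not discharge them; typed ≠
proved for the anabelian inputs; nothing here bears on [IUTchIII] Cor. 3.12 or asserts that abc is proved or refuted.
-/

noncomputable section

open CategoryTheory Topology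

namespace Literature.IUT.HodgeTheaters

namespace PuncturedEllipticData

open scoped Pointwise
open Literature.AnabelianGeometry.AbsoluteAnabelian

universe u

variable {D : PuncturedEllipticData.{u}}

namespace CuspGalois

variable (C : D.CuspGalois)

include C in
/-- **`I_{ε⁰} ⊄ jKer` from the orientation laws (O1) (O2)** and the `Δ_ε`-level laws (L0) `[Δ_X̲ : Ker(↠ Δ_X̲^{ab} ⊗ ℤ/l)]
≠ 0`, (L2a) «`I_{ε′} ≅ ℤ/l` in `Δ_ε`», (L2c) «`0 → I_{ε′} × I_{ε″} → Δ_ε`», (L4) «`Π_X̲` centralises cusp inertia mod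
`Ker`», a geometric representative `ι̲ ∈ Δ_C̲ ∖ Δ_X̲`: the ι-trace of `z₀ ∈ jKer` lies in `Ker(↠ Δ_ε)`, (O2) turns it into
`z₀²`, oddness of `l` into `z₀`, (O1) + (L2c) push `z₁` and then `I_{ε′}` into `Ker(↠ Δ_ε)`, contradicting (L2a).
([IUTchI] §1 p.38) [claim: Mochizuki2012, status: disputed] -/
theorem not_inertia_ε0_le_jKer_of_orientedInertia
    (hfin : D.modLKer.relIndex D.DeltaXbar ≠ 0)
    (hord : D.deltaEpsKer.relIndex (D.inertia D.ε1 ⊔ D.deltaEpsKer) = D.l)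
    (hind : D.inertia D.ε1 ⊓ (D.inertia D.ε2 ⊔ D.deltaEpsKer) ≤ D.deltaEpsKer)
    (hI3 : ∀ (x : D.Cusp), ∀ g ∈ D.PiXbar, ∀ z ∈ D.inertia x, g * z * g⁻¹ * z⁻¹ ∈ D.modLKer)
    (hι : ∃ c ∈ D.DeltaCbar, c ∉ D.DeltaXbar)
    (hprod : ∃ z₀ ∈ D.inertia D.ε0, ∃ z₁ ∈ D.inertia D.ε1, ∃ z₂ ∈ D.inertia D.ε2,
      D.inertia D.ε1 ≤ (Subgroup.zpowers z₁).topologicalClosure ∧ z₀ * z₁ * z₂ ∈ D.deltaEpsKer)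
    (hfix : ∀ c ∈ D.DeltaCbar, c ∉ D.DeltaXbar → ∀ z ∈ D.inertia D.ε0, c * z * c⁻¹ * z⁻¹ ∈ D.modLKer) :
    ¬ D.inertia D.ε0 ≤ D.jKer := by
  intro hle
  obtain ⟨c, hc, hcX⟩ := hι
  obtain ⟨z₀, hz₀, z₁, hz₁, z₂, hz₂, hgen₁, hprod⟩ := hprod
  have hz₀Δ : z₀ ∈ D.DeltaXbar := D.inertia_le_deltaXbar _ hz₀
  have hz₁Δ : z₁ ∈ D.DeltaXbar := D.inertia_le_deltaXbar _ hz₁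
  haveI hMn : D.modLKer.Normal := C.normal_modLKer
  -- the ι-trace of `z₀ ∈ jKer` lies in `Ker(Δ_X̲ ↠ Δ_ε)`
  have htr : z₀ * (c * z₀ * c⁻¹) ∈ D.deltaEpsKer := C.trace_mem_deltaEpsKer_of_mem_jKer hI3 hc hcX (hle hz₀)
  -- (O2): `ι̲ z₀ ι̲⁻¹ ≡ z₀`, so `z₀² ∈ Ker(Δ_X̲ ↠ Δ_ε)`
  have hm : c * z₀ * c⁻¹ * z₀⁻¹ ∈ D.modLKer := hfix c hc hcX z₀ hz₀
  have hm' : z₀⁻¹ * (c * z₀ * c⁻¹ * z₀⁻¹) * z₀⁻¹⁻¹ ∈ D.modLKer := hMn.conj_mem _ hm z₀⁻¹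
  have hsq : z₀ * z₀ ∈ D.deltaEpsKer := by
    have e : z₀ * z₀ = (z₀ * (c * z₀ * c⁻¹)) * (z₀⁻¹ * (c * z₀ * c⁻¹ * z₀⁻¹) * z₀⁻¹⁻¹)⁻¹ := by group
    rw [e]
    exact D.deltaEpsKer.mul_mem htr (D.deltaEpsKer.inv_mem (D.modLKer_le_deltaEpsKer hm'))
  -- `l` odd: `z₀ = (z₀²)^k · (z₀^l)⁻¹ ∈ Ker(Δ_X̲ ↠ Δ_ε)`
  have hz₀E : z₀ ∈ D.deltaEpsKer := by
    obtain ⟨k, hk⟩ := D.exists_l_succ_eq_two_mul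
    have e : z₀ = (z₀ ^ D.l)⁻¹ * (z₀ * z₀) ^ k := by
      rw [← pow_two, ← pow_mul, ← hk, pow_succ, ← mul_assoc, inv_mul_cancel, one_mul]
    rw [e]
    exact D.deltaEpsKer.mul_mem (D.deltaEpsKer.inv_mem (D.modLKer_le_deltaEpsKer (D.pow_l_mem_modLKer hz₀Δ)))
      (D.deltaEpsKer.pow_mem hsq k)
  -- (O1): `z₁ z₂ ∈ Ker(Δ_X̲ ↠ Δ_ε)`, so by (L2c) `z₁ ∈ Ker(Δ_X̲ ↠ Δ_ε)`
  have h12 : z₁ * z₂ ∈ D.deltaEpsKer := by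
    have e : z₁ * z₂ = z₀⁻¹ * (z₀ * z₁ * z₂) := by group
    rw [e]
    exact D.deltaEpsKer.mul_mem (D.deltaEpsKer.inv_mem hz₀E) hprod
  have hz₁E : z₁ ∈ D.deltaEpsKer := by
    refine hind ⟨hz₁, ?_⟩
    have e : z₁ = (z₁ * z₂) * z₂⁻¹ := by group
    rw [e]
    exact Subgroup.mul_mem _ (Subgroup.mem_sup_right h12) (Subgroup.mem_sup_left (Subgroup.inv_mem _ hz₂))
  -- (L0): `I_{ε′} ⊆ ⟨z₁⟩ · Ker ⊆ Ker(Δ_X̲ ↠ Δ_ε)`, contradicting (L2a)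
  have hI₁ : D.inertia D.ε1 ≤ D.deltaEpsKer := by
    refine (D.le_zpowers_sup_of_le_closure hfin D.modLKer_le_deltaEpsKer D.deltaEpsKer_le_deltaXbar hz₁Δ
      hgen₁).trans (sup_le ?_ le_rfl)
    exact (Subgroup.zpowers_le (G := D.PiC)).mpr hz₁E
  have h1 : D.deltaEpsKer.relIndex (D.inertia D.ε1 ⊔ D.deltaEpsKer) = 1 := by
    rw [sup_eq_right.mpr hI₁, Subgroup.relIndex_self]
  have h5 := D.five_le
  rw [← hord, h1] at h5
  omega

include C in
/-- **The binder `h0` of GAP-LEDGER G-L5d4g6-1 DERIVED**: under the six `Δ_ε`-level laws `ModLCuspLaws`, the cusp action,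
a geometric representative of `Gal(X̲/C̲)` and the orientation laws (O1) (O2), the zero cusp `ε⁰` is RAMIFIED in
`X̲→ → X̲`: `¬ I_{ε⁰} ⊆ Π_{X̲→}` (as `Π_{X̲→} ∩ Δ_C = jKer`, `ArrowCoveringClaims.piXarrow_inf_delta`).
([IUTchI] Cor 1.2 p.39) [claim: Mochizuki2012, status: disputed] -/
theorem not_inertia_ε0_le_piXarrow_of_orientedInertia (hL : D.ModLCuspLaws)
    (hι : ∃ c ∈ D.DeltaCbar, c ∉ D.DeltaXbar)
    (hprod : ∃ z₀ ∈ D.inertia D.ε0, ∃ z₁ ∈ D.inertia D.ε1, ∃ z₂ ∈ D.inertia D.ε2,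
      D.inertia D.ε1 ≤ (Subgroup.zpowers z₁).topologicalClosure ∧ z₀ * z₁ * z₂ ∈ D.deltaEpsKer)
    (hfix : ∀ c ∈ D.DeltaCbar, c ∉ D.DeltaXbar → ∀ z ∈ D.inertia D.ε0, c * z * c⁻¹ * z⁻¹ ∈ D.modLKer) :
    ¬ D.inertia D.ε0 ≤ D.piXarrow := by
  intro hle
  have hA : D.ArrowCoveringClaims := C.arrowCoveringClaims_of_modLCuspLaws hL hι
  refine C.not_inertia_ε0_le_jKer_of_orientedInertia hL.modLKer_relIndex_ne_zero hL.inertia_ε1_image_order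
    hL.inertia_images_inf_le hL.inertia_central hι hprod hfix ?_
  rw [← hA.piXarrow_inf_delta]
  exact le_inf hle (inf_le_right : D.decomp D.ε0 ⊓ D.DeltaC ≤ D.DeltaC)

include C in
/-- **The law «`I_{ε⁰} · jKer = Δ_X̲`» (the disposition-of-record shape of G-L5d4g6-1, abc-iut-L5-t7's
`not_inertia_ε0_le_piXarrow_iff_sup`) DERIVED for prime `l`** from `ModLCuspLaws`, the cusp action, a geometric `ι̲` and
the orientation laws (O1) (O2). ([IUTchI] Cor 1.2 p.39) [claim: Mochizuki2012, status: disputed] -/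
theorem inertia_ε0_sup_jKer_of_orientedInertia (hL : D.ModLCuspLaws) (hl : D.l.Prime)
    (hι : ∃ c ∈ D.DeltaCbar, c ∉ D.DeltaXbar)
    (hprod : ∃ z₀ ∈ D.inertia D.ε0, ∃ z₁ ∈ D.inertia D.ε1, ∃ z₂ ∈ D.inertia D.ε2,
      D.inertia D.ε1 ≤ (Subgroup.zpowers z₁).topologicalClosure ∧ z₀ * z₁ * z₂ ∈ D.deltaEpsKer)
    (hfix : ∀ c ∈ D.DeltaCbar, c ∉ D.DeltaXbar → ∀ z ∈ D.inertia D.ε0, c * z * c⁻¹ * z⁻¹ ∈ D.modLKer) :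
    D.inertia D.ε0 ⊔ D.jKer = D.DeltaXbar :=
  (C.arrowCoveringClaims_of_modLCuspLaws hL hι).inertia_sup_jKer_eq_of_not_le hl
    (C.not_inertia_ε0_le_piXarrow_of_orientedInertia hL hι hprod hfix)

end CuspGalois

end PuncturedEllipticData

/-! ### At an initial Θ-datum ([IUTchI] Def. 3.1): the binder `h0` of the Layer-5 Cor. 1.2 closers -/

namespace InitialThetaData

open scoped Pointwise
open Literature.AlgebraicGeometry.Frobenioids (IsSlimGroup)
open Literature.AnabelianGeometry.AbsoluteAnabelian
open Literature.AnabelianGeometry.AbsoluteAnabelian.FundamentalExtension (CuspidalAlgorithm)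
open Literature.AnabelianGeometry.AbsoluteAnabelian.AbsTopI (ConstructionDataClass)
open Literature.AnabelianGeometry.AbsoluteAnabelian.AbsTopII (EllipticModel)

universe u u'

variable {F : Type u} {K : Type} {Fbar : Type} [Field F] [NumberField F] [Field K] [NumberField K]
  [Algebra F K] [Field Fbar] [Algebra F Fbar] [Algebra K Fbar]
  {E : WeierstrassCurve F} [E.IsElliptic] {l : ℕ} {Pb : BadPlacePredicates K}
  (D : InitialThetaData F K Fbar E l Pb)
  {F' : Type u'} {K' : Type} [Field F'] [NumberField F'] [Field K'] [NumberField K'] [Algebra F' K']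
  {Fbar' : Type} [Field Fbar'] [Algebra F' Fbar'] [Algebra K' Fbar']
  {E' : WeierstrassCurve F'} [E'.IsElliptic] {l' : ℕ} {Pb' : BadPlacePredicates K'}
  (D' : InitialThetaData F' K' Fbar' E' l' Pb')

/-- **The binder `h0 : ¬ I_{ε⁰} ⊆ Π_{X̲→_K}` of the [IUTchI] Cor. 1.2 closers at an initial Θ-datum, DERIVED** from the
origin record (A) (c′) (abc-iut-L5-t1's `GeomOrigin`), the four printed `Δ_ε`-sentences (L2a) (L2c) (L3) (L4), the cusp action
and the orientation laws (O1) (O2) — the geometric representative of `Gal(X̲_K/C̲_K)` exists by Def. 3.1 (d)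
(`ThetaGeometry.not_PiCbar_le_PiX`, `ThetaGeometry.aug_PiXbar`). ([IUTchI] Cor 1.2 p.39) [claim: Mochizuki2012, status: disputed] -/
theorem pe_not_inertia_ε0_le_piXarrow_of_geomOrigin_orientedInertia (O : D.geom.pe.GeomOrigin)
    (C : D.geom.pe.CuspGalois)
    (hL2a : D.geom.pe.deltaEpsKer.relIndex (D.geom.pe.inertia D.geom.pe.ε1 ⊔ D.geom.pe.deltaEpsKer) = D.geom.pe.l)
    (hL2c : D.geom.pe.inertia D.geom.pe.ε1 ⊓ (D.geom.pe.inertia D.geom.pe.ε2 ⊔ D.geom.pe.deltaEpsKer) ≤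
      D.geom.pe.deltaEpsKer)
    (hL3 : ∀ c ∈ D.geom.pe.DeltaCbar, c ∉ D.geom.pe.DeltaXbar → ∀ v ∈ D.geom.pe.DeltaXbar,
      c * v * c⁻¹ * v ∈ D.geom.pe.inertia D.geom.pe.ε1 ⊔ D.geom.pe.inertia D.geom.pe.ε2 ⊔ D.geom.pe.deltaEpsKer)
    (hL4 : ∀ x : D.geom.pe.Cusp, ∀ g ∈ D.geom.pe.PiXbar, ∀ z ∈ D.geom.pe.inertia x,
      g * z * g⁻¹ * z⁻¹ ∈ D.geom.pe.modLKer)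
    (hprod : ∃ z₀ ∈ D.geom.pe.inertia D.geom.pe.ε0, ∃ z₁ ∈ D.geom.pe.inertia D.geom.pe.ε1,
      ∃ z₂ ∈ D.geom.pe.inertia D.geom.pe.ε2,
        D.geom.pe.inertia D.geom.pe.ε1 ≤ (Subgroup.zpowers z₁).topologicalClosure ∧
          z₀ * z₁ * z₂ ∈ D.geom.pe.deltaEpsKer)
    (hfix : ∀ c ∈ D.geom.pe.DeltaCbar, c ∉ D.geom.pe.DeltaXbar → ∀ z ∈ D.geom.pe.inertia D.geom.pe.ε0,
      c * z * c⁻¹ * z⁻¹ ∈ D.geom.pe.modLKer) :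
    ¬ D.geom.pe.inertia D.geom.pe.ε0 ≤ D.geom.pe.piXarrow :=
  C.not_inertia_ε0_le_piXarrow_of_orientedInertia
    (D.geom.pe.modLCuspLaws_of_freePro_commutatorCusp O.isFreeProOn O.inertia_eq_conj_commutator hL2a hL2c hL3 hL4)
    (D.geom.pe.exists_mem_deltaCbar_not_mem_deltaXbar D.geom.not_PiCbar_le_PiX D.geom.aug_PiXbar) hprod hfix

/-- **[IUTchI] Cor. 1.2 between the `K`-level data of two initial Θ-data — GRAND KNIT over a class of [AbsTopI] Example 4.8
(i) with the GAP binders `h0 h0′` (G-L5d4g6-1) REPLACED by the orientation laws (O1) (O2) at the two data**: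
`pe_characteristicNatureOfCoverings_of_geomOrigin_ex48` (p496734) ∘ `pe_not_inertia_ε0_le_piXarrow_of_geomOrigin_orientedInertia`.
TELESCOPE: DATA `C C′ A O O′` + model/realisation data · FACT F-0193 `hEx` · F-0294 `h33` · F-0206 `hA hA′` · CLASS SHAPE `h𝒟`
· LAW = the eight printed `Δ_ε`-sentences (L2a) (L2c) (L3) (L4) ×2 + the orientation laws (O1) (O2) ×2 (`hprod hfix hprod′
hfix′`, origin-shaped) — NO GAP-LEDGER binder. ([IUTchI] Cor 1.2 p.39) [claim: Mochizuki2012, status: disputed] -/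
theorem pe_characteristicNatureOfCoverings_of_geomOrigin_ex48_orientedEps0
    (O : D.geom.pe.GeomOrigin) (O' : D'.geom.pe.GeomOrigin)
    (C : D.geom.pe.CuspGalois) (C' : D'.geom.pe.CuspGalois)
    -- a class of [AbsTopI] Example 4.8 (i) with its named fact F-0193, a Cor 3.3/3.4 model over it, F-0294 by name
    {𝒟 : ConstructionDataClass.{0}} {p : ℕ} [Fact p.Prime] (h𝒟 : 𝒟.IsEx48ClassGen p) (hEx : 𝒟.Ex_4_8_i p)
    (M : EllipticModel 𝒟) (h33 : M.Cor_3_3_i)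
    -- members X, X′ over number fields, realised by Π_{X̲→}, Π′_{X̲→} with k-cores Π_C, Π′_C
    {bX bX' : 𝒟.Base} [NumberField (𝒟.fld bX)] [NumberField (𝒟.fld bX')]
    {X : (𝒟.datum bX).Obj} {X' : (𝒟.datum bX').Obj}
    (hmemX : 𝒟.Mem bX X) (hadmX : M.IsEllipticallyAdmissible bX X) (hΔX : IsSlimGroup ((𝒟.datum bX).ext X).geom)
    (hneX : ((𝒟.datum bX).ext X).geom ≠ ⊥) (htfgX : ((𝒟.datum bX).ext X).GeomTFG)
    (hmemX' : 𝒟.Mem bX' X') (hadmX' : M.IsEllipticallyAdmissible bX' X') (hΔX' : IsSlimGroup ((𝒟.datum bX').ext X').geom)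
    (hneX' : ((𝒟.datum bX').ext X').geom ≠ ⊥) (htfgX' : ((𝒟.datum bX').ext X').GeomTFG)
    (hS : (𝒟.datum bX').primes = (𝒟.datum bX).primes)
    (ePi : ((𝒟.datum bX).ext X).arith ≃ₜ* D.geom.pe.piXarrow) (eC : (M.coreExt bX X).arith ≃ₜ* D.geom.pe.PiC)
    (hcomp : ∀ x, eC ((M.toCore bX X).arith x) = (ePi x : D.geom.pe.PiC))
    (ePi' : ((𝒟.datum bX').ext X').arith ≃ₜ* D'.geom.pe.piXarrow) (eC' : (M.coreExt bX' X').arith ≃ₜ* D'.geom.pe.PiC)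
    (hcomp' : ∀ x, eC' ((M.toCore bX' X').arith x) = (ePi' x : D'.geom.pe.PiC))
    -- members Y, Y′ over number fields, realised by Π_{C̲→}, Π′_{C̲→} with k-cores Π_C, Π′_C
    {bY bY' : 𝒟.Base} [NumberField (𝒟.fld bY)] [NumberField (𝒟.fld bY')]
    {Y : (𝒟.datum bY).Obj} {Y' : (𝒟.datum bY').Obj}
    (hmemY : 𝒟.Mem bY Y) (hadmY : M.IsEllipticallyAdmissible bY Y) (hΔY : IsSlimGroup ((𝒟.datum bY).ext Y).geom)
    (hneY : ((𝒟.datum bY).ext Y).geom ≠ ⊥) (htfgY : ((𝒟.datum bY).ext Y).GeomTFG)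
    (hmemY' : 𝒟.Mem bY' Y') (hadmY' : M.IsEllipticallyAdmissible bY' Y') (hΔY' : IsSlimGroup ((𝒟.datum bY').ext Y').geom)
    (hneY' : ((𝒟.datum bY').ext Y').geom ≠ ⊥) (htfgY' : ((𝒟.datum bY').ext Y').GeomTFG)
    (hSY : (𝒟.datum bY').primes = (𝒟.datum bY).primes)
    (fPi : ((𝒟.datum bY).ext Y).arith ≃ₜ* D.geom.pe.piCarrow) (fC : (M.coreExt bY Y).arith ≃ₜ* D.geom.pe.PiC)
    (hcompY : ∀ x, fC ((M.toCore bY Y).arith x) = (fPi x : D.geom.pe.PiC))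
    (fPi' : ((𝒟.datum bY').ext Y').arith ≃ₜ* D'.geom.pe.piCarrow) (fC' : (M.coreExt bY' Y').arith ≃ₜ* D'.geom.pe.PiC)
    (hcompY' : ∀ x, fC' ((M.toCore bY' Y').arith x) = (fPi' x : D'.geom.pe.PiC))
    -- the eight printed Δ_ε-level sentences (L2a)(L2c)(L3)(L4) at the two data
    (hL2a : D.geom.pe.deltaEpsKer.relIndex (D.geom.pe.inertia D.geom.pe.ε1 ⊔ D.geom.pe.deltaEpsKer) = D.geom.pe.l)
    (hL2c : D.geom.pe.inertia D.geom.pe.ε1 ⊓ (D.geom.pe.inertia D.geom.pe.ε2 ⊔ D.geom.pe.deltaEpsKer) ≤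
      D.geom.pe.deltaEpsKer)
    (hL3 : ∀ c ∈ D.geom.pe.DeltaCbar, c ∉ D.geom.pe.DeltaXbar → ∀ v ∈ D.geom.pe.DeltaXbar,
      c * v * c⁻¹ * v ∈ D.geom.pe.inertia D.geom.pe.ε1 ⊔ D.geom.pe.inertia D.geom.pe.ε2 ⊔ D.geom.pe.deltaEpsKer)
    (hL4 : ∀ x : D.geom.pe.Cusp, ∀ g ∈ D.geom.pe.PiXbar, ∀ z ∈ D.geom.pe.inertia x,
      g * z * g⁻¹ * z⁻¹ ∈ D.geom.pe.modLKer)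
    (hL2a' : D'.geom.pe.deltaEpsKer.relIndex (D'.geom.pe.inertia D'.geom.pe.ε1 ⊔ D'.geom.pe.deltaEpsKer) =
      D'.geom.pe.l)
    (hL2c' : D'.geom.pe.inertia D'.geom.pe.ε1 ⊓ (D'.geom.pe.inertia D'.geom.pe.ε2 ⊔ D'.geom.pe.deltaEpsKer) ≤
      D'.geom.pe.deltaEpsKer)
    (hL3' : ∀ c ∈ D'.geom.pe.DeltaCbar, c ∉ D'.geom.pe.DeltaXbar → ∀ v ∈ D'.geom.pe.DeltaXbar,
      c * v * c⁻¹ * v ∈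
        D'.geom.pe.inertia D'.geom.pe.ε1 ⊔ D'.geom.pe.inertia D'.geom.pe.ε2 ⊔ D'.geom.pe.deltaEpsKer)
    (hL4' : ∀ x : D'.geom.pe.Cusp, ∀ g ∈ D'.geom.pe.PiXbar, ∀ z ∈ D'.geom.pe.inertia x,
      g * z * g⁻¹ * z⁻¹ ∈ D'.geom.pe.modLKer)
    -- the orientation laws (O1) (O2) at the two data
    (hprod : ∃ z₀ ∈ D.geom.pe.inertia D.geom.pe.ε0, ∃ z₁ ∈ D.geom.pe.inertia D.geom.pe.ε1,
      ∃ z₂ ∈ D.geom.pe.inertia D.geom.pe.ε2,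
        D.geom.pe.inertia D.geom.pe.ε1 ≤ (Subgroup.zpowers z₁).topologicalClosure ∧
          z₀ * z₁ * z₂ ∈ D.geom.pe.deltaEpsKer)
    (hfix : ∀ c ∈ D.geom.pe.DeltaCbar, c ∉ D.geom.pe.DeltaXbar → ∀ z ∈ D.geom.pe.inertia D.geom.pe.ε0,
      c * z * c⁻¹ * z⁻¹ ∈ D.geom.pe.modLKer)
    (hprod' : ∃ z₀ ∈ D'.geom.pe.inertia D'.geom.pe.ε0, ∃ z₁ ∈ D'.geom.pe.inertia D'.geom.pe.ε1,
      ∃ z₂ ∈ D'.geom.pe.inertia D'.geom.pe.ε2,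
        D'.geom.pe.inertia D'.geom.pe.ε1 ≤ (Subgroup.zpowers z₁).topologicalClosure ∧
          z₀ * z₁ * z₂ ∈ D'.geom.pe.deltaEpsKer)
    (hfix' : ∀ c ∈ D'.geom.pe.DeltaCbar, c ∉ D'.geom.pe.DeltaXbar → ∀ z ∈ D'.geom.pe.inertia D'.geom.pe.ε0,
      c * z * c⁻¹ * z⁻¹ ∈ D'.geom.pe.modLKer)
    -- [AbsTopI] Lem 4.5 (v) (F-0206)
    (A : CuspidalAlgorithm.{0}) (hA : A.RecoversCusps D.geom.pe.extXbar C.cuspidalDataXbar)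
    (hA' : A.RecoversCusps D'.geom.pe.extXbar C'.cuspidalDataXbar) :
    D.geom.pe.CharacteristicNatureOfCoverings D'.geom.pe :=
  D.pe_characteristicNatureOfCoverings_of_geomOrigin_ex48 D' O O' C C' h𝒟 hEx M h33 hmemX hadmX hΔX hneX htfgX hmemX'
    hadmX' hΔX' hneX' htfgX' hS ePi eC hcomp ePi' eC' hcomp' hmemY hadmY hΔY hneY htfgY hmemY' hadmY' hΔY' hneY' htfgY'
    hSY fPi fC hcompY fPi' fC' hcompY' hL2a hL2c hL3 hL4 hL2a' hL2c' hL3' hL4'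
    (D.pe_not_inertia_ε0_le_piXarrow_of_geomOrigin_orientedInertia O C hL2a hL2c hL3 hL4 hprod hfix)
    (D'.pe_not_inertia_ε0_le_piXarrow_of_geomOrigin_orientedInertia O' C' hL2a' hL2c' hL3' hL4' hprod' hfix')
    A hA hA'

end InitialThetaData

end Literature.IUT.HodgeTheaters

end
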